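import Literature.MathematicalPhysics.QuantumFieldTheory.Balaban1983to89.B13TermWalkDataOneTorus
import Literature.MathematicalPhysics.QuantumFieldTheory.Balaban1983to89.B9SectDSup

/-!
# Spine/NE5/TwoRunTorusWalkNumerics — the p. 17 NUMERICS of T25 ∕ T26 ∕ T29 ∕ T33 in THRESHOLD FORM: jointly satisfiable,
# of the printed kind «κ sufficiently large, ε sufficiently small», in the printed ORDER of choices
# (cell `pub-balaban-gaps`, seat `ne5` gen 10)

WHY.  T25 `TwoRunTorusWalkParam.hol_and_h226_torus_of_termWalkData_param` (and T26∕T27∕T29∕T33 through it) carries, besides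
the walk record and the non-walk data, SIX real-number side conditions in the record's letters — `hsm : SmallTheta w α θ`
(NODE A's smallness: `2K̄_Γ(e^{−εR_σ} + α∕R) ≤ θ`, `2K̄_E(…) ≤ θ`), `hθR1le` (the derived (2.16)-letters `θ_Γ, θ_C` against
`θ`), `hsmallKθ` (`K̄_C·P₄·θ·P₅ < 1`), `hαc`, `hsmall` (the Gaussian-integral conditions `(2θP₅ + γ₂ + a₂₀)·c_E ≤ ½`,
`(2θP₅ + γ₂ + a₂₀)(1 + 2c_E g) ≤ ½`) and `hvol` (the per-term volume factor against `a₅|Z|`) — located typing point (x11):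
a consumer of an ∃-packaged (v)⁺ must know they are jointly satisfiable and in which order the letters are chosen.  THIS
FILE answers that AS ONE THEOREM `numerics_of_thresholds`: for ANY non-negative letters (`K̄_Γ, K̄_E, K̄_C`, fibre bounds,
rates, `c_E`, `g`) the six conditions hold as soon as, IN THIS ORDER, (1) the (2.20)∕(2.22) constants satisfy
`γ₂ + a₂₀ ≤ G` with `4Gc_E ≤ 1` and `4G(1 + 2c_E g) ≤ 1`; (2) the target `θ` satisfies `2θP₅ ≤ G` and
`2θ(K̄_C P₄ P₅ + 1) ≤ 1`; (3) the walk package's decay∕reach number `s := e^{−εR_σ} + α∕R` satisfies `s·(2K̄_Γ + 2K̄_E + Q) ≤ θ`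
with `Q` the explicit coefficient of `hθR1le`; (4) the volume constant `a₅ ≥ 2n_Λ + w₀ + n_N∕2` where `n_Λ|Z|, n_N|Z|, w₀|Z|`
bound the term's row count, column count and (2.20)-constant.  This is exactly print's order ([II] p. 7 «if e^{32κ₁}ε₁ is
smaller than an absolute constant», p. 20 «Assuming that 2(L+2)⁴O(1)ε₂ exp 5κ ≤ 1», p. 21 «for κ sufficiently large, and ε₁
sufficiently small») and certifies that T25's hypotheses are NOT vacuous (cf. T14's `numerics_nonvacuous_pencil`).

HONEST FRAMING.  Real-number bookkeeping only; every letter is a free non-negative real; nothing of Bałaban's is constructed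
or asserted; which values his operators produce is NODE O's statement (v)⁺.  NE5 NOT PRINTED ∕ NOT PROVED; leaves 0∕12;
(D4) 0∕1; spine 0∕9.  Rung (B)+1 on a FIXED finite T⁴ — NOT continuum, NOT infinite volume, NOT mass gap, NOT Clay.
0 sorry, 0 `def`.

Sources: [II] = T. Bałaban, CMP **116** (1988) [Balaban1988RG2Cluster] p. 7, (2.16) p. 16, (2.20)–(2.26) pp. 16–17,
p. 20, p. 21.  Nothing here is a claim about the Yang–Mills mass gap.
-/

noncomputable section

namespace Summit.QuantumFields.BalabanUV.T4Continuum.Spine.NE5.TwoRunTorusWalkNumerics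

open Literature.MathematicalPhysics.QuantumFieldTheory.Balaban1983to89
open Literature.MathematicalPhysics.QuantumFieldTheory.Balaban1983to89.B13TermWalkData (WalkConsts)
open Literature.MathematicalPhysics.QuantumFieldTheory.Balaban1983to89.B13TermWalkDataOneTorus (SmallTheta)
open Literature.MathematicalPhysics.QuantumFieldTheory.Balaban1983to89.B9SectDSup (inv_one_sub_le_two)

/-- Splitting ONE smallness `s·(a + b + q) ≤ θ` into its three summands (`a, b, q, s ≥ 0`). [folklore] -/
theorem split_smallness {s a b q θ : ℝ} (hs : 0 ≤ s) (ha : 0 ≤ a) (hb : 0 ≤ b) (hq : 0 ≤ q)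
    (h : s * (a + b + q) ≤ θ) : a * s ≤ θ ∧ b * s ≤ θ ∧ s * q ≤ θ := by
  refine ⟨?_, ?_, ?_⟩ <;> nlinarith [mul_nonneg hs ha, mul_nonneg hs hb, mul_nonneg hs hq]

/-- **The θ-group of the p. 17 numerics** (`hsmallKθ`, `hαc`, `hsmall`, and `A ≤ ½` for `hvol`) from the thresholds
`2θP₅ ≤ G`, `2θ(K̄_C P₄ P₅ + 1) ≤ 1`, `γ₂ + a₂₀ ≤ G`, `4Gc_E ≤ 1`, `4G(1 + 2c_E g) ≤ 1` — plain real letters.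
[cite: Balaban1988RG2Cluster, (2.20)–(2.26) pp.16–17] -/
theorem theta_group {KC P4 P5 θ G γ₂ a₂₀ cE g : ℝ} (hKC : 0 ≤ KC) (hP4 : 0 ≤ P4) (hP5 : 0 ≤ P5) (hθ0 : 0 ≤ θ)
    (hcE : 0 ≤ cE) (hg : 0 ≤ g) (hγ₂ : 0 ≤ γ₂) (ha₂₀ : 0 ≤ a₂₀)
    (hG : γ₂ + a₂₀ ≤ G) (hGc : 4 * G * cE ≤ 1) (hGg : 4 * G * (1 + 2 * cE * g) ≤ 1)
    (hθG : 2 * θ * P5 ≤ G) (hθK : 2 * θ * (KC * P4 * P5 + 1) ≤ 1) :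
    KC * P4 * (θ * P5) < 1 ∧ (2 * (θ * P5) + (γ₂ + a₂₀)) * cE ≤ 1 / 2 ∧
      (2 * (θ * P5) + (γ₂ + a₂₀)) * (1 + 2 * cE * g) ≤ 1 / 2 ∧ KC * P4 * (θ * P5) ≤ 1 / 2 := by
  have hKP : 0 ≤ KC * P4 * P5 := mul_nonneg (mul_nonneg hKC hP4) hP5
  have hA : KC * P4 * (θ * P5) ≤ 1 / 2 := by
    have : KC * P4 * (θ * P5) = θ * (KC * P4 * P5) := by ring
    rw [this]; nlinarith [hθK, hθ0, hKP]
  have hX0 : 0 ≤ 2 * (θ * P5) + (γ₂ + a₂₀) := by positivity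
  have hX2G : 2 * (θ * P5) + (γ₂ + a₂₀) ≤ 2 * G := by
    have : 2 * (θ * P5) = 2 * θ * P5 := by ring
    linarith [hθG, hG]
  have hD0 : 0 ≤ 1 + 2 * cE * g := by positivity
  refine ⟨by linarith [hA], ?_, ?_, hA⟩
  · nlinarith [hX2G, hGc, hcE, hX0]
  · nlinarith [hX2G, hGg, hD0, hX0]

/-- **The volume condition `hvol`** from `A ≤ ½`, the two Gaussian conditions and the sizes `|Λ| ≤ n_Λ|Z|`,
`|Λ ⊕ C₀| ≤ n_N|Z|`, `w₂₀ ≤ w₀|Z|`, with `a₅ ≥ 2n_Λ + w₀ + n_N∕2` — plain real letters.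
[cite: Balaban1988RG2Cluster, (2.26) p.17] -/
theorem vol_group {A X cE g cΛ cN w₂₀ a₅ nΛ nN w₀ nZ : ℝ} (hA0 : 0 ≤ A) (hA : A ≤ 1 / 2)
    (hXc : X * cE ≤ 1 / 2) (hXg : X * (1 + 2 * cE * g) ≤ 1 / 2)
    (hcΛ : cΛ ≤ nΛ * nZ) (hcN : cN ≤ nN * nZ) (hcΛ0 : 0 ≤ cΛ) (hcN0 : 0 ≤ cN) (hw₂₀ : w₂₀ ≤ w₀ * nZ)
    (hnZ : 0 ≤ nZ) (ha₅ : 2 * nΛ + w₀ + nN / 2 ≤ a₅) :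
    2 * (A * (1 + (1 - A)⁻¹) / 2) * cΛ + w₂₀ + X * cE * cΛ + X * (1 + 2 * cE * g) * cN ≤ a₅ * nZ := by
  have hinv : (1 - A)⁻¹ ≤ 2 := inv_one_sub_le_two hA
  have hinv0 : 0 ≤ (1 - A)⁻¹ := inv_nonneg.2 (by linarith)
  have hA3 : A * (1 + (1 - A)⁻¹) ≤ 3 / 2 := by nlinarith [hA, hinv, hA0, hinv0]
  have h1st : 2 * (A * (1 + (1 - A)⁻¹) / 2) * cΛ ≤ (3 / 2) * cΛ := by nlinarith [hA3, hcΛ0]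
  have h3rd : X * cE * cΛ ≤ (1 / 2) * cΛ := by nlinarith [hXc, hcΛ0]
  have h4th : X * (1 + 2 * cE * g) * cN ≤ (1 / 2) * cN := by nlinarith [hXg, hcN0]
  have hsum : (3 / 2) * cΛ + w₂₀ + (1 / 2) * cΛ + (1 / 2) * cN ≤ (2 * nΛ + w₀ + nN / 2) * nZ := by
    nlinarith [hcΛ, hcN, hw₂₀, hnZ]
  have ha₅' : (2 * nΛ + w₀ + nN / 2) * nZ ≤ a₅ * nZ := mul_le_mul_of_nonneg_right ha₅ hnZ
  linarith [h1st, h3rd, h4th, hsum, ha₅']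

/-- **THE p. 17 NUMERICS OF T25 IN THRESHOLD FORM (jointly satisfiable, printed order of choices).**  Letters: the walk
package `w` (only `K̄_Γ, K̄_E, K̄_C ≥ 0`, `ε, R_σ, R` enter), the configuration size `α ≥ 0`, the fibre polynomials
`P₄ = (m(1+2∕κ_b))^ν`, `P₅ = (m(1+2∕κ″))^ν`, `P₁ = (m(1+2∕(κ_b−κ′)))^ν(m(1+2∕(κ′−κ″)))^ν`, `P₂ = (m_𝒦(1+2∕(κ−κ_a)))^ν`,
`P₃ = (m_𝒦(1+2∕(κ_a−κ_b)))^ν`, the spectral letters `c_E, g ≥ 0`, the (2.20)∕(2.22) constants `γ₂, a₂₀ ≥ 0`, `w₂₀`, the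
sizes `|Λ| ≤ n_Λ|Z|`, `|Λ ⊕ C₀| ≤ n_N|Z|`, `w₂₀ ≤ w₀|Z|`.  Thresholds, in print's ORDER: (1) `γ₂ + a₂₀ ≤ G`, `4Gc_E ≤ 1`,
`4G(1 + 2c_E g) ≤ 1`; (2) `2θP₅ ≤ G`, `2θ(K̄_C P₄ P₅ + 1) ≤ 1`; (3) `(e^{−εR_σ} + α∕R)·(2K̄_Γ + 2K̄_E + Q) ≤ θ` with `Q` the
coefficient of `hθR1le`; (4) `a₅ ≥ 2n_Λ + w₀ + n_N∕2`.  Conclusions, LITERALLY the binders of T25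
`hol_and_h226_torus_of_termWalkData_param` (with `m ↦ m`, `𝒦.m ↦ mK`, `Fintype.card 𝒦.Λ ↦ cΛ`,
`Fintype.card (𝒦.Λ ⊕ 𝒦.C₀) ↦ cN`, `(Z.1).card ↦ nZ`): `hsm : SmallTheta w α θ`, `hθR1le`, `hsmallKθ`, `hαc`, `hsmall`, `hvol`.
[cite: Balaban1988RG2Cluster, p.7, (2.16) p.16, (2.20)–(2.26) pp.16–17, p.20, p.21] -/
theorem numerics_of_thresholds (w : WalkConsts) (hKΓ : 0 ≤ w.KbarΓ) (hKE : 0 ≤ w.KbarE) (hKC : 0 ≤ w.KbarC)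
    {α : ℝ} (hα : 0 ≤ α) (hR : 0 < w.R)
    {m mK : ℝ} (hm : 0 ≤ m) (hmK : 0 ≤ mK) {ν : ℕ}
    {kap κa κb kap' kap'' : ℝ} (hκa : κa < kap) (hκb : κb < κa) (h2 : kap' < κb) (h1 : kap'' < kap') (hkap'' : 0 < kap'')
    {θ G γ₂ a₂₀ w₂₀ cE g a₅ nΛ nN w₀ nZ cΛ cN : ℝ} (hcE : 0 ≤ cE) (hg : 0 ≤ g) (hγ₂ : 0 ≤ γ₂) (ha₂₀ : 0 ≤ a₂₀)
    (hθ0 : 0 ≤ θ) (hnZ : 0 ≤ nZ)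
    -- (1) the (2.20)∕(2.22) constants against the spectral letters
    (hG : γ₂ + a₂₀ ≤ G) (hGc : 4 * G * cE ≤ 1) (hGg : 4 * G * (1 + 2 * cE * g) ≤ 1)
    -- (2) the target θ
    (hθG : 2 * θ * (m * (1 + 2 / kap'') ^ ν) ≤ G)
    (hθK : 2 * θ * (w.KbarC * (m * (1 + 2 / κb) ^ ν) * (m * (1 + 2 / kap'') ^ ν) + 1) ≤ 1)
    -- (3) the walk package's decay ∕ reach number against θ
    (hs : (Real.exp (-(w.ε * w.Rσ)) + α / w.R) *
        (2 * w.KbarΓ + 2 * w.KbarE +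
          (m * (1 + 2 / (κb - kap')) ^ ν) * (m * (1 + 2 / (kap' - kap'')) ^ ν) *
            (2 * w.KbarΓ * w.KbarC * w.KbarΓ
              + w.KbarΓ * (w.KbarC * (2 * w.KbarE) * (mK * (1 + 2 / (kap - κa)) ^ ν) * w.KbarC
                  * (mK * (1 + 2 / (κa - κb)) ^ ν)) * w.KbarΓ
              + w.KbarΓ * w.KbarC * (2 * w.KbarΓ))) ≤ θ)
    -- (4) the sizes and the volume constant
    (hcΛ : cΛ ≤ nΛ * nZ) (hcN : cN ≤ nN * nZ) (hcΛ0 : 0 ≤ cΛ) (hcN0 : 0 ≤ cN) (hw₂₀ : w₂₀ ≤ w₀ * nZ)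
    (ha₅ : 2 * nΛ + w₀ + nN / 2 ≤ a₅) :
    SmallTheta w α θ ∧
    -- hθR1le
    ((m * (1 + 2 / (κb - kap')) ^ ν) * (m * (1 + 2 / (kap' - kap'')) ^ ν)
      * ((2 * w.KbarΓ * Real.exp (-(w.ε * w.Rσ)) + 2 * w.KbarΓ * α / w.R) * w.KbarC * w.KbarΓ
        + w.KbarΓ * (w.KbarC * (2 * w.KbarE * Real.exp (-(w.ε * w.Rσ)) + 2 * w.KbarE * α / w.R)
            * (mK * (1 + 2 / (kap - κa)) ^ ν) * w.KbarC * (mK * (1 + 2 / (κa - κb)) ^ ν)) * w.KbarΓ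
        + w.KbarΓ * w.KbarC * (2 * w.KbarΓ * Real.exp (-(w.ε * w.Rσ)) + 2 * w.KbarΓ * α / w.R)) ≤ θ) ∧
    -- hsmallKθ
    (w.KbarC * (m * (1 + 2 / κb) ^ ν) * (θ * (m * (1 + 2 / kap'') ^ ν)) < 1) ∧
    -- hαc
    ((2 * (θ * (m * (1 + 2 / kap'') ^ ν)) + (γ₂ + a₂₀)) * cE ≤ 1 / 2) ∧
    -- hsmall
    ((2 * (θ * (m * (1 + 2 / kap'') ^ ν)) + (γ₂ + a₂₀)) * (1 + 2 * cE * g) ≤ 1 / 2) ∧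
    -- hvol
    (2 * (w.KbarC * (m * (1 + 2 / κb) ^ ν) * (θ * (m * (1 + 2 / kap'') ^ ν))
            * (1 + (1 - w.KbarC * (m * (1 + 2 / κb) ^ ν) * (θ * (m * (1 + 2 / kap'') ^ ν)))⁻¹) / 2) * cΛ
        + w₂₀ + (2 * (θ * (m * (1 + 2 / kap'') ^ ν)) + (γ₂ + a₂₀)) * cE * cΛ
        + (2 * (θ * (m * (1 + 2 / kap'') ^ ν)) + (γ₂ + a₂₀)) * (1 + 2 * cE * g) * cN ≤ a₅ * nZ) := by
  -- positivity of the rates and of the fibre polynomials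
  have hκb0 : 0 < κb := hkap''.trans (h1.trans h2)
  have hP5 : 0 ≤ (m * (1 + 2 / kap'') ^ ν) := by positivity
  have hP4 : 0 ≤ (m * (1 + 2 / κb) ^ ν) := by positivity
  have hP1a : 0 ≤ (m * (1 + 2 / (κb - kap')) ^ ν) := by
    have : 0 < κb - kap' := sub_pos.2 h2
    positivity
  have hP1b : 0 ≤ (m * (1 + 2 / (kap' - kap'')) ^ ν) := by
    have : 0 < kap' - kap'' := sub_pos.2 h1
    positivity
  have hP2 : 0 ≤ (mK * (1 + 2 / (kap - κa)) ^ ν) := by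
    have : 0 < kap - κa := sub_pos.2 hκa
    positivity
  have hP3 : 0 ≤ (mK * (1 + 2 / (κa - κb)) ^ ν) := by
    have : 0 < κa - κb := sub_pos.2 hκb
    positivity
  have hs0 : 0 ≤ Real.exp (-(w.ε * w.Rσ)) + α / w.R := by positivity
  have hQ0 : 0 ≤ (m * (1 + 2 / (κb - kap')) ^ ν) * (m * (1 + 2 / (kap' - kap'')) ^ ν) *
      (2 * w.KbarΓ * w.KbarC * w.KbarΓ
        + w.KbarΓ * (w.KbarC * (2 * w.KbarE) * (mK * (1 + 2 / (kap - κa)) ^ ν) * w.KbarC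
            * (mK * (1 + 2 / (κa - κb)) ^ ν)) * w.KbarΓ
        + w.KbarΓ * w.KbarC * (2 * w.KbarΓ)) := by positivity
  -- (3) split into NODE A's two letters and the `hθR1le` coefficient
  obtain ⟨hsΓ, hsE, hsQ⟩ := split_smallness hs0 (by positivity) (by positivity) hQ0 hs
  -- (2)+(1): the θ-group
  obtain ⟨hK1, hXc, hXg, hAhalf⟩ := theta_group hKC hP4 hP5 hθ0 hcE hg hγ₂ ha₂₀ hG hGc hGg hθG hθK
  refine ⟨⟨hsΓ, hsE⟩, ?_, hK1, hXc, hXg, ?_⟩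
  · -- hθR1le: the left side is LINEAR in the decay ∕ reach number
    have hlin : (m * (1 + 2 / (κb - kap')) ^ ν) * (m * (1 + 2 / (kap' - kap'')) ^ ν)
        * ((2 * w.KbarΓ * Real.exp (-(w.ε * w.Rσ)) + 2 * w.KbarΓ * α / w.R) * w.KbarC * w.KbarΓ
          + w.KbarΓ * (w.KbarC * (2 * w.KbarE * Real.exp (-(w.ε * w.Rσ)) + 2 * w.KbarE * α / w.R)
              * (mK * (1 + 2 / (kap - κa)) ^ ν) * w.KbarC * (mK * (1 + 2 / (κa - κb)) ^ ν)) * w.KbarΓ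
          + w.KbarΓ * w.KbarC * (2 * w.KbarΓ * Real.exp (-(w.ε * w.Rσ)) + 2 * w.KbarΓ * α / w.R)) =
        (Real.exp (-(w.ε * w.Rσ)) + α / w.R) *
          ((m * (1 + 2 / (κb - kap')) ^ ν) * (m * (1 + 2 / (kap' - kap'')) ^ ν) *
            (2 * w.KbarΓ * w.KbarC * w.KbarΓ
              + w.KbarΓ * (w.KbarC * (2 * w.KbarE) * (mK * (1 + 2 / (kap - κa)) ^ ν) * w.KbarC
                  * (mK * (1 + 2 / (κa - κb)) ^ ν)) * w.KbarΓ
              + w.KbarΓ * w.KbarC * (2 * w.KbarΓ))) := by ring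
    rw [hlin]; exact hsQ
  · -- hvol
    exact vol_group (by positivity) hAhalf hXc hXg hcΛ hcN hcΛ0 hcN0 hw₂₀ hnZ ha₅

/-- **T29's positivity smallness `hsmallRe` in threshold form**: with NODE A's letter `2K̄_E(e^{−εR_σ} + α∕R) ≤ θ` (half of
`SmallTheta`, delivered by `numerics_of_thresholds`) and the extra θ-threshold `2θ·(m(1+2∕κ)^ν·c_E) ≤ 1`, the binder
`hsmallRe : θ_E(w,α)·(m(1+2∕κ)^ν)·c_E < 1` of T29 `TwoRunTorusWalkOutputLetters.differentiableOn_E_torus_of_records_symm` ∕ T32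
holds (its `hcE`, `hgE` are the consumer's CHOICE of `c_E := K̄_C·m(1+2∕κ)^ν`, `g := c_E(K̄_Γ·m(1+2∕κ)^ν)²`, made before `G`).
[cite: Balaban1988RG2Cluster, p.15, (2.16) p.16, (2.24) p.17] -/
theorem smallRe_of_thresholds (w : WalkConsts) (hKE : 0 ≤ w.KbarE) {α : ℝ} (hα : 0 ≤ α) (hR : 0 < w.R)
    {m : ℝ} (hm : 0 ≤ m) {ν : ℕ} {kap θ cE : ℝ} (hkap : 0 < kap) (hcE : 0 ≤ cE)
    (hsE : 2 * w.KbarE * (Real.exp (-(w.ε * w.Rσ)) + α / w.R) ≤ θ)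
    (hθRe : 2 * θ * ((m * (1 + 2 / kap) ^ ν) * cE) ≤ 1) :
    (2 * w.KbarE * Real.exp (-(w.ε * w.Rσ)) + 2 * w.KbarE * α / w.R) * (m * (1 + 2 / kap) ^ ν) * cE < 1 := by
  have hP : 0 ≤ (m * (1 + 2 / kap) ^ ν) * cE := by positivity
  have hθE0 : 0 ≤ 2 * w.KbarE * (Real.exp (-(w.ε * w.Rσ)) + α / w.R) := by positivity
  have heq : (2 * w.KbarE * Real.exp (-(w.ε * w.Rσ)) + 2 * w.KbarE * α / w.R) * (m * (1 + 2 / kap) ^ ν) * cE =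
      (2 * w.KbarE * (Real.exp (-(w.ε * w.Rσ)) + α / w.R)) * ((m * (1 + 2 / kap) ^ ν) * cE) := by ring
  rw [heq]
  have h1 : (2 * w.KbarE * (Real.exp (-(w.ε * w.Rσ)) + α / w.R)) * ((m * (1 + 2 / kap) ^ ν) * cE) ≤
      θ * ((m * (1 + 2 / kap) ^ ν) * cE) := mul_le_mul_of_nonneg_right hsE hP
  nlinarith [h1, hθRe, hP]

end Summit.QuantumFields.BalabanUV.T4Continuum.Spine.NE5.TwoRunTorusWalkNumerics

end
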